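import Summits.CriticalPhenomena.Ising3D.ExclusionSentencesTrgGamma

/-!
# Exclusion sentences — 2D control `Δ_σ = 1/8` vs the FULL `TRG` table one rung later (`10⁻⁸`), part 1 of 2
(cell `pub-ising3x`, seat recog-1, gen 6)

HONEST FRAMING: lottery ticket; floor = tightest certified 3D Ising CFT bounds; no exact-solution
claim without a proof.

Rule R3 of the frozen protocol (SCOPE.md §3: a member must survive the NEXT certified digit) in kernel form for the
last family that still had members at the blind width: within `10⁻⁶` of `Δ_σ = 1/8` the whole FAMILIES-v1 family
`TRG` (`D ≤ 17`, `h ≤ 32`, with the `Γ(¼)`/`Γ(⅓)` powers) has exactly four members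
(`control_sigma_trgFull`, `ExclusionSentencesControl2DTrgGammaFin.lean`); within `10⁻⁸` it has NONE — the
exception list is EMPTY.  (The Python twin `tools/trg_gamma_exceptions.py` already finds none within `10⁻⁷`; the
`10⁻⁸` width is chosen to match `control_sigma_trg_lin`, whose LIN list empties only at `10⁻⁸`:
`(98 − 3π³ − 3ζ(3))/11` lies within `7·10⁻⁸` of `1/8`.)  This file: parts `0–3` (`trgFullPart`, two `Γ`-classes
each); `ExclusionSentencesControl2DTrgGammaSigma8Fin.lean`: parts `4–7`, the assembled sentence and the printed
shape, used by the catalogue-wide recognition theorem of `ExclusionSentencesControl2DRecognised.lean`.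
No 3D digit is used anywhere.
-/

namespace Summit.CriticalPhenomena.Ising3D

/-- Part 0 (classes `Γ(¼)^{−4}`, `Γ(¼)^{−3}`) of the full-TRG sentence on `[1/8 − 10⁻⁸, 1/8 + 10⁻⁸]`, empty list. -/
theorem trgFull_control_sigma8_p0 :
    trgFullPart 17 32 0 (1 / 8 - 1 / 10 ^ 8) (1 / 8 + 1 / 10 ^ 8) [] = true := by
  decide +kernel

/-- Part 1 (classes `Γ(¼)^{−2}`, `Γ(¼)^{−1}`). -/
theorem trgFull_control_sigma8_p1 :
    trgFullPart 17 32 1 (1 / 8 - 1 / 10 ^ 8) (1 / 8 + 1 / 10 ^ 8) [] = true := by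
  decide +kernel

/-- Part 2 (classes `Γ`-free, `Γ(¼)¹`). -/
theorem trgFull_control_sigma8_p2 :
    trgFullPart 17 32 2 (1 / 8 - 1 / 10 ^ 8) (1 / 8 + 1 / 10 ^ 8) [] = true := by
  decide +kernel

/-- Part 3 (classes `Γ(¼)²`, `Γ(¼)³`). -/
theorem trgFull_control_sigma8_p3 :
    trgFullPart 17 32 3 (1 / 8 - 1 / 10 ^ 8) (1 / 8 + 1 / 10 ^ 8) [] = true := by
  decide +kernel

end Summit.CriticalPhenomena.Ising3D
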